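import Summits.AtomisticToContinuum.FouriersLaw.Theorems.EmbeddedDrudeMourreMourreDissolutionFreeLevelShift
import HarnessLib

/-!
# The force window, part II: positivity of a threshold density by comparison of Poisson integrals
(stub `stub_forceWindow` (KT) of line `gram-pencil-harmonic-chaos`, crux `EmbeddedDrudeMourre.DrudeDissolution`,
item stmt-AtomisticToContinuum-12593; `--supports` file, closes nothing)

WHAT. Let `Ω(p) = resonanceFn ω₂ k₁ k₂ k₃` be the pair resonance function on the cell `(−π,π]³`
(`p = (k₁,(k₃,k₂))`, Lebesgue measure) and `W_sin = Φ²(∏ω)⁻²[sin]²` the bracket weight of the odd profile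
`sin` (the weight of the sibling crux stmt-AtomisticToContinuum-12594). If a continuous weight `W ≥ 0` is
comparable to `L·W_sin` (`L > 0`) up to the resonance function, `|W − L W_sin| ≤ C'|Ω|`, and the pushforward
`Ω_*(W dk)` has a continuous density `ρ ≥ 0` on a window around `0`, then `ρ(0) > 0` as soon as the
linearised Boltzmann form has an odd-sector gap (`HasOddSectorGap ω₂ a b`):
`forceWindow_density_pos` (registered helper, part W3 of stub KT).

HOW. Poisson integrals `P_ν[W] = ∫_cell W·ν/(Ω²+ν²)`: (i) `P_ν[W] → πρ(0)` as `ν ↓ 0` by the landed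
locally uniform Poisson approximate identity `MourreDissolution.stub_poissonLocallyUniform` (B2) and the
pushforward identity `MourreDissolution.levelShift_integral_map_withDensity` (B0); (ii)
`P_ν[W_sin] → (4π/alsPrefactor)·q(sin)` by the landed Fermi golden rule at the threshold
`MourreDissolution.fermiGoldenRule_threshold` (`forceWindow_fgr_sin`, Fubini `levelShift_integral_cell`);
(iii) `|P_ν[W] − L·P_ν[W_sin]| ≤ |C'| ∫ |Ω|ν/(Ω²+ν²) → 0` by dominated convergence — the integrand is
`≤ 1/2` and tends to `0` at EVERY point (it vanishes identically where `Ω = 0`), so no null-set argument is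
needed (`forceWindow_poisson_error_tendsto`, `forceWindow_poisson_transfer`); (iv) `q(sin) > 0` from the gap
(`sin` is odd, `2π`-periodic, `‖sin‖²_cell ≥ 1/2 > 0`) and `q(sin) < ∞`
(`boltzmannForm_lt_top_of_contDiff_two`), so `πρ(0) = L·(4π/alsPrefactor)·q(sin) > 0` by uniqueness of
limits. Real analysis over Mathlib; no cited facts.
-/

noncomputable section

namespace Summit.AtomisticToContinuum.FouriersLaw.Theorems.DrudeDissolution.GramPencilHarmonicChaos

open Real Set MeasureTheory Filter Topology
open scoped ENNReal
open Literature.MathematicalPhysics.KineticTheory.PhononBoltzmann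
open Summit.AtomisticToContinuum.FouriersLaw.Theorems.MourreDissolution

/-! ### The Poisson error term -/

/-- `|Ω|·ν/(Ω² + ν²) ≤ 1/2` (AM–GM). [folklore] -/
theorem forceWindow_abs_mul_poisson_le (x ν : ℝ) : |x| * (ν / (x ^ 2 + ν ^ 2)) ≤ 1 / 2 := by
  by_cases h0 : x ^ 2 + ν ^ 2 = 0
  · have hx : x = 0 := by nlinarith [sq_nonneg x, sq_nonneg ν]
    simp [hx]
  have hpos : 0 < x ^ 2 + ν ^ 2 := lt_of_le_of_ne (by positivity) (Ne.symm h0)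
  rw [← mul_div_assoc, div_le_iff₀ hpos]
  nlinarith [sq_nonneg (|x| - ν), sq_abs x, abs_nonneg x]

/-- `ν ↦ |x|·ν/(x² + ν²)` tends to `0` as `ν → 0` for EVERY `x` (it is identically `0` when `x = 0`).
[folklore] -/
theorem forceWindow_abs_mul_poisson_tendsto (x : ℝ) :
    Tendsto (fun ν : ℝ => |x| * (ν / (x ^ 2 + ν ^ 2))) (𝓝 0) (𝓝 0) := by
  by_cases hx : x = 0
  · subst hx
    refine tendsto_const_nhds.congr fun ν => ?_
    simp
  · have hc : ContinuousAt (fun ν : ℝ => |x| * (ν / (x ^ 2 + ν ^ 2))) 0 := by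
      refine continuousAt_const.mul (continuousAt_id.div (by fun_prop) ?_)
      have : 0 < x ^ 2 := by positivity
      show x ^ 2 + (0 : ℝ) ^ 2 ≠ 0
      positivity
    have h0 : (fun ν : ℝ => |x| * (ν / (x ^ 2 + ν ^ 2))) 0 = 0 := by simp
    simpa [h0] using hc.tendsto

/-- **The Poisson error term vanishes in the limit.** For a continuous `Ω` on `ℝ³`,
`∫_cell |Ω|·ν/(Ω² + ν²) dp → 0` as `ν ↓ 0` (dominated convergence with the bound `1/2`; the
integrand tends to `0` everywhere). [folklore] -/
theorem forceWindow_poisson_error_tendsto {Ω : ℝ × ℝ × ℝ → ℝ} (hΩ : Continuous Ω) :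
    Tendsto (fun ν : ℝ => ∫ p, |Ω p| * (ν / (Ω p ^ 2 + ν ^ 2))
      ∂((volume.restrict (Ioc (-π) π)).prod ((volume.restrict (Ioc (-π) π)).prod
        (volume.restrict (Ioc (-π) π))))) (𝓝[>] (0 : ℝ)) (𝓝 0) := by
  have h := tendsto_integral_filter_of_dominated_convergence
    (μ := (volume.restrict (Ioc (-π) π)).prod ((volume.restrict (Ioc (-π) π)).prod
        (volume.restrict (Ioc (-π) π))))
    (l := 𝓝[>] (0 : ℝ)) (F := fun (ν : ℝ) (p : ℝ × ℝ × ℝ) => |Ω p| * (ν / (Ω p ^ 2 + ν ^ 2)))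
    (f := fun _ => (0 : ℝ)) (fun _ => 1 / 2) ?_ ?_ ?_ ?_
  · simpa using h
  · filter_upwards [self_mem_nhdsWithin] with ν hν
    refine Continuous.aestronglyMeasurable ?_
    exact (continuous_abs.comp hΩ).mul (continuous_const.div (by fun_prop) fun p => by
      have : (0 : ℝ) < ν := hν
      positivity)
  · filter_upwards [self_mem_nhdsWithin] with ν hν
    refine ae_of_all _ fun p => ?_
    rw [Real.norm_eq_abs, abs_of_nonneg (by have : (0 : ℝ) < ν := hν; positivity)]
    exact forceWindow_abs_mul_poisson_le _ _
  · exact levelShift_integrable_cell continuous_const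
  · exact ae_of_all _ fun p => (forceWindow_abs_mul_poisson_tendsto (Ω p)).mono_left nhdsWithin_le_nhds

/-- **Transfer of Poisson limits between comparable weights.** On the cell `(−π,π]³` let `W₁, W₂` be
continuous weights with `|W₁ − L W₂| ≤ C'|Ω|` pointwise for a continuous `Ω`. If
`∫ W₂·ν/(Ω²+ν²) → ℓ` as `ν ↓ 0` then `∫ W₁·ν/(Ω²+ν²) → L·ℓ`. [folklore] -/
theorem forceWindow_poisson_transfer {Ω W₁ W₂ : ℝ × ℝ × ℝ → ℝ} (hΩ : Continuous Ω) (hW₁ : Continuous W₁)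
    (hW₂ : Continuous W₂) {L C' ℓ : ℝ} (hcmp : ∀ p, |W₁ p - L * W₂ p| ≤ C' * |Ω p|)
    (h₂ : Tendsto (fun ν : ℝ => ∫ p, W₂ p * (ν / (Ω p ^ 2 + ν ^ 2))
      ∂((volume.restrict (Ioc (-π) π)).prod ((volume.restrict (Ioc (-π) π)).prod
        (volume.restrict (Ioc (-π) π))))) (𝓝[>] (0 : ℝ)) (𝓝 ℓ)) :
    Tendsto (fun ν : ℝ => ∫ p, W₁ p * (ν / (Ω p ^ 2 + ν ^ 2))
      ∂((volume.restrict (Ioc (-π) π)).prod ((volume.restrict (Ioc (-π) π)).prod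
        (volume.restrict (Ioc (-π) π))))) (𝓝[>] (0 : ℝ)) (𝓝 (L * ℓ)) := by
  set μ : Measure (ℝ × ℝ × ℝ) := (volume.restrict (Ioc (-π) π)).prod ((volume.restrict (Ioc (-π) π)).prod
    (volume.restrict (Ioc (-π) π))) with hμ
  -- the error term
  have hE : Tendsto (fun ν : ℝ => ∫ p, (W₁ p - L * W₂ p) * (ν / (Ω p ^ 2 + ν ^ 2)) ∂μ)
      (𝓝[>] (0 : ℝ)) (𝓝 0) := by
    have hD := (forceWindow_poisson_error_tendsto hΩ).const_mul |C'|
    rw [mul_zero] at hD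
    refine squeeze_zero_norm' ?_ hD
    filter_upwards [self_mem_nhdsWithin] with ν hν
    have hν' : (0 : ℝ) < ν := hν
    have hk : Continuous fun p : ℝ × ℝ × ℝ => ν / (Ω p ^ 2 + ν ^ 2) :=
      continuous_const.div (by fun_prop) fun p => by positivity
    rw [← integral_const_mul]
    refine (norm_integral_le_integral_norm _).trans (integral_mono ?_ ?_ fun p => ?_)
    · exact (levelShift_integrable_cell (G := fun p => (W₁ p - L * W₂ p) * (ν / (Ω p ^ 2 + ν ^ 2)))
        ((hW₁.sub (continuous_const.mul hW₂)).mul hk)).norm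
    · exact levelShift_integrable_cell (G := fun p => |C'| * (|Ω p| * (ν / (Ω p ^ 2 + ν ^ 2))))
        (continuous_const.mul ((continuous_abs.comp hΩ).mul hk))
    · rw [norm_mul, Real.norm_eq_abs, Real.norm_eq_abs, abs_of_nonneg (by positivity : 0 ≤ ν / (Ω p ^ 2 + ν ^ 2)),
        ← mul_assoc]
      refine mul_le_mul_of_nonneg_right ((hcmp p).trans ?_) (by positivity)
      exact mul_le_mul_of_nonneg_right (le_abs_self _) (abs_nonneg _)
  -- the main term
  have hmain := (h₂.const_mul L).add hE
  rw [add_zero] at hmain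
  refine hmain.congr' ?_
  filter_upwards [self_mem_nhdsWithin] with ν hν
  have hν' : (0 : ℝ) < ν := hν
  have hk : Continuous fun p : ℝ × ℝ × ℝ => ν / (Ω p ^ 2 + ν ^ 2) :=
    continuous_const.div (by fun_prop) fun p => by positivity
  have hi₁ : Integrable (fun p => L * (W₂ p * (ν / (Ω p ^ 2 + ν ^ 2)))) μ :=
    levelShift_integrable_cell (G := fun p => L * (W₂ p * (ν / (Ω p ^ 2 + ν ^ 2))))
      (continuous_const.mul (hW₂.mul hk))
  have hi₂ : Integrable (fun p => (W₁ p - L * W₂ p) * (ν / (Ω p ^ 2 + ν ^ 2))) μ :=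
    levelShift_integrable_cell (G := fun p => (W₁ p - L * W₂ p) * (ν / (Ω p ^ 2 + ν ^ 2)))
      ((hW₁.sub (continuous_const.mul hW₂)).mul hk)
  rw [← integral_const_mul, ← integral_add hi₁ hi₂]
  refine integral_congr_ae (ae_of_all _ fun p => ?_)
  ring

/-! ### The reference weight: Fermi's golden rule for the odd profile `sin` -/

/-- **Fermi's golden rule at the threshold for the profile `sin`, product-measure form.** For `ω₂ > 0`
and couplings `a, b`: `∫_cell W_sin·ν/(Ω²+ν²) dp → (4π/alsPrefactor)·q_{ω₂,a,b}(sin)` as `ν ↓ 0`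
(`MourreDissolution.fermiGoldenRule_threshold` with `f = sin`, iterated integrals assembled by Fubini).
[folklore] -/
theorem forceWindow_fgr_sin {ω₂ : ℝ} (hω : 0 < ω₂) (a b : ℝ) :
    Tendsto (fun ν : ℝ => ∫ p : ℝ × ℝ × ℝ,
        vertex a b p.1 p.2.2 p.2.1 ^ 2 /
            (dispersion ω₂ p.1 * dispersion ω₂ p.2.2 * dispersion ω₂ p.2.1 * dispersion ω₂ (p.1 + p.2.2 - p.2.1)) ^ 2 *
          (Real.sin p.1 + Real.sin p.2.2 - Real.sin p.2.1 - Real.sin (p.1 + p.2.2 - p.2.1)) ^ 2 *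
          (ν / (resonanceFn ω₂ p.1 p.2.2 p.2.1 ^ 2 + ν ^ 2))
      ∂((volume.restrict (Ioc (-π) π)).prod ((volume.restrict (Ioc (-π) π)).prod
        (volume.restrict (Ioc (-π) π))))) (𝓝[>] (0 : ℝ))
      (𝓝 (4 * Real.pi / alsPrefactor * (boltzmannForm ω₂ a b Real.sin).toReal)) := by
  have h := fermiGoldenRule_threshold ω₂ a b hω Real.sin Real.sin_periodic Real.contDiff_sin
  refine h.congr' ?_
  filter_upwards [self_mem_nhdsWithin] with ν hν
  have hν' : (0 : ℝ) < ν := hν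
  have hden : ∀ p : ℝ × ℝ × ℝ, (dispersion ω₂ p.1 * dispersion ω₂ p.2.2 * dispersion ω₂ p.2.1 *
      dispersion ω₂ (p.1 + p.2.2 - p.2.1)) ^ 2 ≠ 0 := fun p =>
    pow_ne_zero _ (mul_pos (mul_pos (mul_pos (dispersion_pos hω _) (dispersion_pos hω _))
      (dispersion_pos hω _)) (dispersion_pos hω _)).ne'
  have hG : Continuous fun p : ℝ × ℝ × ℝ => vertex a b p.1 p.2.2 p.2.1 ^ 2 /
      (dispersion ω₂ p.1 * dispersion ω₂ p.2.2 * dispersion ω₂ p.2.1 * dispersion ω₂ (p.1 + p.2.2 - p.2.1)) ^ 2 *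
      (Real.sin p.1 + Real.sin p.2.2 - Real.sin p.2.1 - Real.sin (p.1 + p.2.2 - p.2.1)) ^ 2 *
      (ν / (resonanceFn ω₂ p.1 p.2.2 p.2.1 ^ 2 + ν ^ 2)) := by
    refine (((by fun_prop : Continuous fun p : ℝ × ℝ × ℝ => vertex a b p.1 p.2.2 p.2.1 ^ 2).div
      (by fun_prop) hden).mul (by fun_prop)).mul (continuous_const.div (by fun_prop) fun p => by positivity)
  exact levelShift_integral_cell hG

/-- `‖sin‖²_cell ≥ 1/2`: on `[π/2 − 1, π/2 + 1] ⊆ (−π, π]` one has `sin ≥ 1/2`. [folklore] -/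
theorem forceWindow_cellNormSq_sin_ge : ENNReal.ofReal (1 / 2) ≤ cellNormSq Real.sin := by
  have hpi := Real.pi_gt_three
  have hsub : Icc (π / 2 - 1) (π / 2 + 1) ⊆ Ioc (-π) π := fun x hx => ⟨by linarith [hx.1], by linarith [hx.2]⟩
  have hsin : ∀ x ∈ Icc (π / 2 - 1) (π / 2 + 1), (1 : ℝ) / 4 ≤ Real.sin x ^ 2 := by
    intro x hx
    have h1 : 1 / 2 ≤ Real.cos (x - π / 2) := by
      have hb := Real.one_sub_sq_div_two_le_cos (x := x - π / 2)
      have hx2 : (x - π / 2) ^ 2 ≤ 1 := by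
        have : |x - π / 2| ≤ 1 := abs_le.2 ⟨by linarith [hx.1], by linarith [hx.2]⟩
        nlinarith [abs_nonneg (x - π / 2), sq_abs (x - π / 2)]
      linarith
    rw [Real.cos_sub_pi_div_two] at h1
    nlinarith
  unfold cellNormSq
  calc ENNReal.ofReal (1 / 2) = ENNReal.ofReal (1 / 4) * volume (Icc (π / 2 - 1) (π / 2 + 1)) := by
        rw [Real.volume_Icc, ← ENNReal.ofReal_mul (by norm_num)]
        congr 1; ring
    _ = ∫⁻ _ in Icc (π / 2 - 1) (π / 2 + 1), ENNReal.ofReal (1 / 4) := (setLIntegral_const _ _).symm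
    _ ≤ ∫⁻ x in Icc (π / 2 - 1) (π / 2 + 1), ENNReal.ofReal (Real.sin x ^ 2) :=
        setLIntegral_mono (Real.measurable_sin.pow_const 2).ennreal_ofReal
          fun x hx => ENNReal.ofReal_le_ofReal (hsin x hx)
    _ ≤ ∫⁻ x in Ioc (-π) π, ENNReal.ofReal (Real.sin x ^ 2) := lintegral_mono_set hsub

/-- `‖sin‖²_cell < ∞`. [folklore] -/
theorem forceWindow_cellNormSq_sin_lt_top : cellNormSq Real.sin < ⊤ := by
  unfold cellNormSq
  refine lt_of_le_of_lt (setLIntegral_mono measurable_const (fun x _ => ?_) :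
    ∫⁻ x in Ioc (-π) π, ENNReal.ofReal (Real.sin x ^ 2) ≤ ∫⁻ _ in Ioc (-π) π, (1 : ℝ≥0∞)) ?_
  · rw [← ENNReal.ofReal_one]
    refine ENNReal.ofReal_le_ofReal ?_
    rw [← sq_abs]
    nlinarith [Real.abs_sin_le_one x, abs_nonneg (Real.sin x)]
  · rw [setLIntegral_const, one_mul, Real.volume_Ioc]
    exact ENNReal.ofReal_lt_top

/-- **The golden-rule value of `sin` is positive under the odd-sector gap.** If the linearised Boltzmann
form has an odd-sector gap then `(4π/alsPrefactor)·q_{ω₂,a,b}(sin) > 0` (`sin` is odd, `2π`-periodic,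
square integrable with `‖sin‖² > 0`, and `q(sin) < ∞` for the `C²` profile `sin`). [folklore] -/
theorem forceWindow_fgr_sin_pos {ω₂ a b : ℝ} (hω : 0 < ω₂) (hgap : HasOddSectorGap ω₂ a b) :
    0 < 4 * Real.pi / alsPrefactor * (boltzmannForm ω₂ a b Real.sin).toReal := by
  obtain ⟨g, hg, hgap⟩ := hgap
  have hq := hgap Real.sin Real.sin_periodic Real.measurable_sin (fun x => Real.sin_neg x)
    forceWindow_cellNormSq_sin_lt_top
  have hlt : boltzmannForm ω₂ a b Real.sin < ⊤ :=
    boltzmannForm_lt_top_of_contDiff_two ω₂ a b hω Real.sin Real.sin_periodic Real.contDiff_sin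
  have hpos : 0 < boltzmannForm ω₂ a b Real.sin := by
    refine lt_of_lt_of_le ?_ hq
    refine ENNReal.mul_pos (ENNReal.ofReal_pos.2 hg).ne' ?_
    exact (lt_of_lt_of_le (ENNReal.ofReal_pos.2 (by norm_num)) forceWindow_cellNormSq_sin_ge).ne'
  exact mul_pos (div_pos (by positivity) alsPrefactor_pos) (ENNReal.toReal_pos hpos.ne' hlt.ne)

/-! ### Positivity of the density at the threshold -/

/-- **Positivity at the threshold (W3 of stub KT).** On the cell `(−π,π]³` let `W ≥ 0` be a continuous
weight comparable to `L·W_sin` (`L > 0`, `W_sin = Φ²(∏ω)⁻²[sin]²` read at `p = (k₁,(k₃,k₂))`) up to the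
resonance function: `|W − L W_sin| ≤ C'|Ω|`. If `Ω_*(W dk)` has on a window `(−δ, δ)` a continuous density
`ρ ≥ 0` and the Boltzmann form has an odd-sector gap, then `ρ(0) > 0`: the Poisson integrals of `Ω_*(W dk)`
at `E = 0` tend to `πρ(0)` (B2) and to `L·(4π/alsPrefactor)·q(sin) > 0` (transfer from the golden rule).
[folklore] -/
theorem forceWindow_density_pos_of_window {ω₂ a b : ℝ} (hω : 0 < ω₂) (hgap : HasOddSectorGap ω₂ a b)
    {W : ℝ × ℝ × ℝ → ℝ} (hWc : Continuous W) (hW0 : ∀ p, 0 ≤ W p) {L C' : ℝ} (hL : 0 < L)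
    (hcmp : ∀ p : ℝ × ℝ × ℝ, |W p - L * (vertex a b p.1 p.2.2 p.2.1 ^ 2 /
        (dispersion ω₂ p.1 * dispersion ω₂ p.2.2 * dispersion ω₂ p.2.1 * dispersion ω₂ (p.1 + p.2.2 - p.2.1)) ^ 2 *
      (Real.sin p.1 + Real.sin p.2.2 - Real.sin p.2.1 - Real.sin (p.1 + p.2.2 - p.2.1)) ^ 2)| ≤
      C' * |resonanceFn ω₂ p.1 p.2.2 p.2.1|)
    {δ : ℝ} (hδ : 0 < δ) {ρ : ℝ → ℝ} (hρc : ContinuousOn ρ (Ioo (-δ) δ)) (hρ0 : ∀ x ∈ Ioo (-δ) δ, 0 ≤ ρ x)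
    (hwin : (Measure.map (fun p : ℝ × ℝ × ℝ => resonanceFn ω₂ p.1 p.2.2 p.2.1)
        (((volume.restrict (Ioc (-π) π)).prod ((volume.restrict (Ioc (-π) π)).prod
          (volume.restrict (Ioc (-π) π)))).withDensity (fun p => ENNReal.ofReal (W p)))).restrict (Ioo (-δ) δ) =
      (volume.restrict (Ioo (-δ) δ)).withDensity (fun x => ENNReal.ofReal (ρ x))) :
    0 < ρ 0 := by
  have hΩ : Continuous fun p : ℝ × ℝ × ℝ => resonanceFn ω₂ p.1 p.2.2 p.2.1 := by fun_prop
  haveI hfin := levelShift_isFiniteMeasure_map (fun p : ℝ × ℝ × ℝ => resonanceFn ω₂ p.1 p.2.2 p.2.1) hWc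
  -- B2 at `E = 0`
  have h0mem : (0 : ℝ) ∈ Ioo (-δ) δ := ⟨by linarith, hδ⟩
  have hB2 := (stub_poissonLocallyUniform _ hfin δ hδ ρ hρc hρ0 hwin).tendsto_at h0mem
  simp only [sub_zero] at hB2
  -- the Poisson integrals of the pushforward are the cell integrals `∫ W·ν/(Ω²+ν²)`
  have hB2' : Tendsto (fun ν : ℝ => ∫ p, W p * (ν / (resonanceFn ω₂ p.1 p.2.2 p.2.1 ^ 2 + ν ^ 2))
      ∂((volume.restrict (Ioc (-π) π)).prod ((volume.restrict (Ioc (-π) π)).prod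
        (volume.restrict (Ioc (-π) π))))) (𝓝[>] (0 : ℝ)) (𝓝 (Real.pi * ρ 0)) := by
    refine hB2.congr' ?_
    filter_upwards [self_mem_nhdsWithin] with ν hν
    have hν' : (0 : ℝ) < ν := hν
    have hP : Continuous fun x : ℝ => ν / (x ^ 2 + ν ^ 2) :=
      continuous_const.div (by fun_prop) fun x => by positivity
    exact levelShift_integral_map_withDensity hWc hW0 hΩ hP
  -- transfer from the golden rule for `sin`
  have hW₂ : Continuous fun p : ℝ × ℝ × ℝ => vertex a b p.1 p.2.2 p.2.1 ^ 2 /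
      (dispersion ω₂ p.1 * dispersion ω₂ p.2.2 * dispersion ω₂ p.2.1 * dispersion ω₂ (p.1 + p.2.2 - p.2.1)) ^ 2 *
      (Real.sin p.1 + Real.sin p.2.2 - Real.sin p.2.1 - Real.sin (p.1 + p.2.2 - p.2.1)) ^ 2 := by
    have hden : ∀ p : ℝ × ℝ × ℝ, (dispersion ω₂ p.1 * dispersion ω₂ p.2.2 * dispersion ω₂ p.2.1 *
        dispersion ω₂ (p.1 + p.2.2 - p.2.1)) ^ 2 ≠ 0 := fun p =>
      pow_ne_zero _ (mul_pos (mul_pos (mul_pos (dispersion_pos hω _) (dispersion_pos hω _))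
        (dispersion_pos hω _)) (dispersion_pos hω _)).ne'
    exact ((by fun_prop : Continuous fun p : ℝ × ℝ × ℝ => vertex a b p.1 p.2.2 p.2.1 ^ 2).div
      (by fun_prop) hden).mul (by fun_prop)
  have hT := forceWindow_poisson_transfer hΩ hWc hW₂ hcmp (forceWindow_fgr_sin hω a b)
  have heq : Real.pi * ρ 0 = L * (4 * Real.pi / alsPrefactor * (boltzmannForm ω₂ a b Real.sin).toReal) :=
    tendsto_nhds_unique hB2' hT
  have hpos : 0 < Real.pi * ρ 0 := by
    rw [heq]; exact mul_pos hL (forceWindow_fgr_sin_pos hω hgap)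
  exact pos_of_mul_pos_right hpos Real.pi_pos.le


/-- **Registered helper (stub KT, part W3): positivity of the threshold density.** For `ω₂ > 0` with the
odd-sector gap, a continuous weight `W ≥ 0` on the cell comparable to `L·W_sin` (`L > 0`) up to the
resonance function, `|W − L W_sin| ≤ C'|Ω|`, whose pushforward `Ω_*(W dk)` has a continuous density `ρ ≥ 0`
on a window `(−δ, δ)`, has `ρ(0) > 0` — `forceWindow_density_pos_of_window` in the registered `∀`-form.
[folklore] -/
theorem forceWindow_density_pos : ∀ ω₂ a b : ℝ, 0 < ω₂ → Literature.MathematicalPhysics.KineticTheory.PhononBoltzmann.HasOddSectorGap ω₂ a b → ∀ (W : ℝ × ℝ × ℝ → ℝ) (L C' δ : ℝ) (ρ : ℝ → ℝ), Continuous W → (∀ p : ℝ × ℝ × ℝ, 0 ≤ W p) → 0 < L → (∀ p : ℝ × ℝ × ℝ, |W p - L * (Literature.MathematicalPhysics.KineticTheory.PhononBoltzmann.vertex a b p.1 p.2.2 p.2.1 ^ 2 / (Literature.MathematicalPhysics.KineticTheory.PhononBoltzmann.dispersion ω₂ p.1 * Literature.MathematicalPhysics.KineticTheory.PhononBoltzmann.dispersion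 ω₂ p.2.2 * Literature.MathematicalPhysics.KineticTheory.PhononBoltzmann.dispersion ω₂ p.2.1 * Literature.MathematicalPhysics.KineticTheory.PhononBoltzmann.dispersion ω₂ (p.1 + p.2.2 - p.2.1)) ^ 2 * (Real.sin p.1 + Real.sin p.2.2 - Real.sin p.2.1 - Real.sin (p.1 + p.2.2 - p.2.1)) ^ 2)| ≤ C' * |Literature.MathematicalPhysics.KineticTheory.PhononBoltzmann.resonanceFn ω₂ p.1 p.2.2 p.2.1|) → 0 < δ → ContinuousOn ρ (Set.Ioo (-δ) δ) → (∀ x ∈ Set.Ioo (-δ) δ, 0 ≤ ρ x) → (MeasureTheory.Measure.map (fun p : ℝ × ℝ × ℝ => Literature.MathematicalPhysics.KineticTheory.PhononBoltzmann.resonanceFn ω₂ p.1 p.2.2 p.2.1) (((MeasureTheory.volume.restrict (Set.Ioc (-Real.pi) Real.pi)).prod ((MeasureTheory.volume.restrict (Set.Ioc (-Real.pi) Real.pi)).prod (MeasureTheory.volume.restrict (Set.Ioc (-Real.pi) Real.pi)))).withDensity (fun p : ℝ × ℝ × ℝ => ENNReal.ofReal (W p)))).restrict (Set.Ioo (-δ)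 δ) = (MeasureTheory.volume.restrict (Set.Ioo (-δ) δ)).withDensity (fun x => ENNReal.ofReal (ρ x)) → 0 < ρ 0 :=
  fun _ _ _ hω hgap _ _ _ _ _ hWc hW0 hL hcmp hδ hρc hρ0 hwin =>
    forceWindow_density_pos_of_window hω hgap hWc hW0 hL hcmp hδ hρc hρ0 hwin

end Summit.AtomisticToContinuum.FouriersLaw.Theorems.DrudeDissolution.GramPencilHarmonicChaos

end
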